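import Mathlib
import Summits.ValiantsHypothesis.ValiantsHypothesis.Theses.FeketeSOS

/-!
# Sketch — crux FeketeSOSHard (stmt-ValiantsHypothesis-3996), ideator 1, idea `border-depth-dichotomy`

First lemmas of the line (statements only; they must elaborate, they need not be proved here).
-/

open Polynomial Finset BigOperators Classical

namespace Summit.ValiantsHypothesis.ValiantsHypothesis.Cruxes.FeketeSOSHard.BorderDepth

/-- The Fekete polynomial with coefficients pushed into a ring `R` (the route items inline it over `ℂ`). -/
noncomputable def fekete (R : Type*) [CommRing R] (p : ℕ) [Fact p.Prime] : Polynomial R :=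
  ∑ m ∈ Finset.range p, C (((legendreSym p m : ℤ)) : R) * X ^ m

/-- FIRST LEMMA (char-`p` slice of the dichotomy, provable now).
Over a field of characteristic `p` (odd), a weighted SOS representation of `u • F̄_p` modulo `X^p - 1`
(`u ≠ 0`, squares of degree `< p`) either contains a FAT square — one `g i` with at least `(p+3)/4`
monomials — or is CANCELLING at `X = 1`: the minimal order of vanishing `m` at `1` among the live squares
satisfies `2m < (p-1)/2` and the leading Taylor coefficients of the squares of that order sum to zero.
(Engine: Euler's criterion gives `(X-1)^{(p-1)/2} ∥ F̄_p`; char-`p` Hajós: `(X-1)^a ∣ g`, `g ≠ 0`,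
`deg g < p` ⇒ `a + 1 ≤ #supp g`.) -/
def CharPSOSOrderDichotomy : Prop :=
  ∀ (k : Type) [Field k] (p : ℕ) [Fact p.Prime] [CharP k p], p ≠ 2 →
    ∀ (s : ℕ) (c : Fin s → k) (g : Fin s → Polynomial k) (u : k), u ≠ 0 →
      (∀ i, (g i).natDegree < p) →
      (X ^ p - 1 : Polynomial k) ∣ ((∑ i, C (c i) * g i ^ 2) - C u * fekete k p) →
      (∃ i, c i ≠ 0 ∧ (p + 3) / 4 ≤ (g i).support.card) ∨
      (∃ m : ℕ, 2 * m < (p - 1) / 2 ∧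
        (∀ i, c i ≠ 0 → g i ≠ 0 → m ≤ (g i).rootMultiplicity 1) ∧
        (∃ i, c i ≠ 0 ∧ g i ≠ 0 ∧ (g i).rootMultiplicity 1 = m) ∧
        (∑ i ∈ (Finset.univ.filter fun i => c i ≠ 0 ∧ g i ≠ 0 ∧ (g i).rootMultiplicity 1 = m),
            c i * (((g i) /ₘ ((X - C 1) ^ m)).eval 1) ^ 2) = 0)

/-- The moment identity behind "F̄_p is the pure monomial `-z^{(p-1)/2}/((p-1)/2)!` in the coordinate
`z = log x` of `k[x]/(x^p-1) ≅ k[z]/(z^p)`": the twisted power sums of the Legendre symbol vanish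
mod `p` except at exponent `(p-1)/2`. (Euler's criterion + power sums over `𝔽_p`; provable now.) -/
def FeketeTwistedMoments : Prop :=
  ∀ (k : Type) [Field k] (p : ℕ) [Fact p.Prime] [CharP k p], p ≠ 2 →
    ∀ u : ℕ, u < p →
      (∑ n ∈ Finset.range p, (((legendreSym p n : ℤ)) : k) * (n : k) ^ u)
        = if u = (p - 1) / 2 then -1 else 0

/-- TRANSFER TARGET (★) = `CharPSparseSOS`: the characteristic-`p` (cyclic) shadow of the crux.
Few sparse squares cannot represent the reduced Fekete element `F̄_p = Σ n^{(p-1)/2} x^n` in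
`k[x]/(x^p - 1)` for `k` of characteristic `p`: same exponent shape as the crux.  Any depth-0
(`𝔭`-adically non-cancelling at the Gauss level) complex representation reduces to an instance. -/
def CharPSparseSOS : Prop :=
  ∃ δ : ℝ, 0 < δ ∧ ∃ p₀ : ℕ, ∀ (p : ℕ) [Fact p.Prime], p₀ ≤ p →
    ∀ (k : Type) [Field k] [CharP k p] (s : ℕ) (c : Fin s → k) (g : Fin s → Polynomial k) (u : k),
      u ≠ 0 → (s : ℝ) ≤ (p : ℝ) ^ δ → (∀ i, (g i).natDegree < p) →
      (X ^ p - 1 : Polynomial k) ∣ ((∑ i, C (c i) * g i ^ 2) - C u * fekete k p) →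
      (p : ℝ) ^ (1 / 2 + δ) ≤ ∑ i, ((g i).support.card : ℝ)

/-- LINEAR form of (★) suggested by all small cases computed (p ≤ 13): support-sum ≥ p/4 for ANY number
of squares (the non-cancelling branch of the dichotomy gives exactly `(p+3)/4` for one square). -/
def CharPSparseSOSLinear : Prop :=
  ∀ (p : ℕ) [Fact p.Prime], p ≠ 2 →
    ∀ (k : Type) [Field k] [CharP k p] (s : ℕ) (c : Fin s → k) (g : Fin s → Polynomial k) (u : k),
      u ≠ 0 → (∀ i, (g i).natDegree < p) →
      (X ^ p - 1 : Polynomial k) ∣ ((∑ i, C (c i) * g i ^ 2) - C u * fekete k p) →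
      (p + 3) / 4 ≤ ∑ i, (g i).support.card

/-- The crux, by name (read-back check that the Sketch sees the route decl). -/
example : Summit.ValiantsHypothesis.ValiantsHypothesis.Theses.FeketeSOS.FeketeSOSHard =
    (∃ δ : ℝ, 0 < δ ∧ ∃ p₀ : ℕ, ∀ (p : ℕ) [Fact p.Prime], p₀ ≤ p → ∀ (s : ℕ) (c : Fin s → ℂ)
      (g : Fin s → Polynomial ℂ), (s : ℝ) ≤ (p : ℝ) ^ δ → (∀ i, (g i).natDegree ≤ p ^ 2) →
      (∑ i, Polynomial.C (c i) * g i ^ 2) = ∑ m ∈ Finset.range p, Polynomial.C ((legendreSym p m : ℤ) : ℂ) * Polynomial.X ^ m →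
      (p : ℝ) ^ (1 / 2 + δ) ≤ ∑ i, ((g i).support.card : ℝ)) := rfl

end Summit.ValiantsHypothesis.ValiantsHypothesis.Cruxes.FeketeSOSHard.BorderDepth
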